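import Summits.AtomisticToContinuum.HydrodynamicLimit.Theorems.StiffCollisionalRelaxationAprioriBoundsFibreDefs
import HarnessLib

/-!
# The lever `stub_deficitTransfer` of the line `fibre-deficit-transfer` (crux `AprioriBounds`,
stmt-AtomisticToContinuum-14827), part 2a: uniform bounds of the tilt fields on the compact slab

Support file (`--supports stmt-AtomisticToContinuum-14827`) of the lead prover of the line.  The lever takes the fields
`(ρ, u, θ)` of the classical solution only through joint continuity on the slab `[0,t] × 𝕋³`, `θ > 0`, and joint
continuity of the density multiplier `λ₀` along them.  Compactness of the slab turns these into UNIFORM constants: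
`|Λ(s,x)·(1,v,|v|²/2)| ≤ A₀ + |v|²/θ_min` (`exists_abs_tiltExponent_le`), `|m_s| ≤ M` (`exists_abs_tiltMean_le`), and the
affine energy bound on the linear statistic `|ℓ_s(w)| ≤ A₁ + (2/θ_min)·E(w)/(N+1)` (`exists_abs_linStat_le`, registered
sub-goal), which part 2 (`…FibreDeficitMeanBound`) integrates against the rate event and the energy moment.
-/

noncomputable section

open MeasureTheory Filter Set Topology
open scoped ENNReal

namespace Summit.AtomisticToContinuum.HydrodynamicLimit.Theorems.FibreDeficitTransfer

open Literature.MathematicalPhysics.KineticTheory Literature.Analysis.FluidPDE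
open Summit.AtomisticToContinuum.HydrodynamicLimit.Theorems.VisitLedgerUpscattering (Cfg Flow Flows NiceProfiles)

variable {σ : ℝ} {ρ θ : ℝ → T3 → ℝ} {u : ℝ → T3 → V3} {t : ℝ}

/-! ## Uniform bounds on the compact slab -/

/-- Slices of a field jointly continuous on the slab `[0,t] × 𝕋³` are continuous. -/
theorem continuous_slice {Y : Type*} [TopologicalSpace Y] {f : ℝ → T3 → Y}
    (hf : ContinuousOn (Function.uncurry f) (Icc 0 t ×ˢ univ)) {s : ℝ} (hs : s ∈ Icc 0 t) : Continuous (f s) :=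
  hf.comp_continuous (f := fun x : T3 => (s, x)) (continuous_const.prodMk continuous_id) fun x => ⟨hs, mem_univ x⟩

/-- A real function continuous on the compact slab is bounded there. -/
theorem exists_bound_slab {f : ℝ × T3 → ℝ} (hf : ContinuousOn f (Icc 0 t ×ˢ univ)) :
    ∃ C : ℝ, 0 ≤ C ∧ ∀ s ∈ Icc 0 t, ∀ x, |f (s, x)| ≤ C := by
  obtain ⟨C, hC⟩ := (isCompact_Icc.prod isCompact_univ).exists_bound_of_continuousOn hf
  refine ⟨max C 0, le_max_right _ _, fun s hs x => ?_⟩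
  have h := hC (s, x) ⟨hs, mem_univ x⟩
  rw [Real.norm_eq_abs] at h
  exact h.trans (le_max_left _ _)

/-- A positive function continuous on the compact slab is bounded below by a positive constant. -/
theorem exists_pos_lower_bound_slab {f : ℝ → T3 → ℝ} (hf : ContinuousOn (Function.uncurry f) (Icc 0 t ×ˢ univ))
    (ht : 0 ≤ t) (hpos : ∀ s ∈ Icc 0 t, ∀ x, 0 < f s x) :
    ∃ m : ℝ, 0 < m ∧ ∀ s ∈ Icc 0 t, ∀ x, m ≤ f s x := by
  have hne : (Icc 0 t ×ˢ (univ : Set T3)).Nonempty := ⟨(0, 0), ⟨⟨le_rfl, ht⟩, mem_univ _⟩⟩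
  obtain ⟨p, hp, hmin⟩ := (isCompact_Icc.prod isCompact_univ).exists_isMinOn hne hf
  refine ⟨f p.1 p.2, hpos p.1 hp.1 p.2, fun s hs x => ?_⟩
  exact hmin (show (s, x) ∈ Icc 0 t ×ˢ (univ : Set T3) from ⟨hs, mem_univ x⟩)

/-- **Uniform quadratic bound on the tilt exponent.**  On the slab, `|Λ(s,x)·(1,v,|v|²/2)| ≤ A₀ + |v|²/θ_min`. -/
theorem exists_abs_tiltExponent_le (hθc : ContinuousOn (Function.uncurry θ) (Icc 0 t ×ˢ univ))
    (huc : ContinuousOn (Function.uncurry u) (Icc 0 t ×ˢ univ)) (ht : 0 ≤ t) (hθ : ∀ s ∈ Icc 0 t, ∀ x, 0 < θ s x)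
    (hΛ : ContinuousOn (fun p : ℝ × T3 => lam0 σ (ρ p.1 p.2) (θ p.1 p.2) (u p.1 p.2)) (Icc 0 t ×ˢ univ)) :
    ∃ A₀ θm : ℝ, 0 ≤ A₀ ∧ 0 < θm ∧ (∀ s ∈ Icc 0 t, ∀ x, θm ≤ θ s x) ∧
      ∀ s ∈ Icc 0 t, ∀ (x : T3) (v : V3), |tiltExponent σ ρ θ u s (x, v)| ≤ A₀ + ‖v‖ ^ 2 / θm := by
  obtain ⟨L, hL0, hL⟩ := exists_bound_slab hΛ
  obtain ⟨U, hU0, hU⟩ := exists_bound_slab (f := fun p : ℝ × T3 => ‖u p.1 p.2‖) (huc.norm)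
  obtain ⟨θm, hθm, hθmle⟩ := exists_pos_lower_bound_slab hθc ht hθ
  refine ⟨L + U ^ 2 / (2 * θm), θm, by positivity, hθm, hθmle, fun s hs x v => ?_⟩
  have hθsx : θm ≤ θ s x := hθmle s hs x
  have hθpos : 0 < θ s x := hθ s hs x
  have hUx : ‖u s x‖ ≤ U := (le_abs_self _).trans (hU s hs x)
  have hLx : |lam0 σ (ρ s x) (θ s x) (u s x)| ≤ L := hL s hs x
  rw [tiltExponent]
  -- `|⟪u, v⟫/θ| ≤ U|v|/θm ≤ (U² + |v|²)/(2 θm)` and `|v|²/(2θ) ≤ |v|²/(2θm)`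
  have h1 : |inner ℝ (u s x) v / θ s x| ≤ (U ^ 2 + ‖v‖ ^ 2) / (2 * θm) := by
    rw [abs_div, abs_of_pos hθpos, div_le_div_iff₀ hθpos (by positivity)]
    have hin : |inner ℝ (u s x) v| ≤ U * ‖v‖ :=
      (abs_real_inner_le_norm _ _).trans (mul_le_mul_of_nonneg_right hUx (norm_nonneg _))
    have h2 : 2 * (U * ‖v‖) ≤ U ^ 2 + ‖v‖ ^ 2 := by nlinarith [sq_nonneg (U - ‖v‖)]
    calc |inner ℝ (u s x) v| * (2 * θm) ≤ U * ‖v‖ * (2 * θm) := by gcongr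
      _ = 2 * (U * ‖v‖) * θm := by ring
      _ ≤ (U ^ 2 + ‖v‖ ^ 2) * θm := by gcongr
      _ ≤ (U ^ 2 + ‖v‖ ^ 2) * θ s x := by gcongr
  have h2 : |‖v‖ ^ 2 / (2 * θ s x)| ≤ ‖v‖ ^ 2 / (2 * θm) := by
    rw [abs_of_nonneg (by positivity)]
    gcongr
  calc |lam0 σ (ρ s x) (θ s x) (u s x) + inner ℝ (u s x) v / θ s x - ‖v‖ ^ 2 / (2 * θ s x)|
      ≤ |lam0 σ (ρ s x) (θ s x) (u s x)| + |inner ℝ (u s x) v / θ s x| + |‖v‖ ^ 2 / (2 * θ s x)| := abs_add_sub_le_three _ _ _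
    _ ≤ L + (U ^ 2 + ‖v‖ ^ 2) / (2 * θm) + ‖v‖ ^ 2 / (2 * θm) := by gcongr
    _ = L + U ^ 2 / (2 * θm) + ‖v‖ ^ 2 / θm := by field_simp; ring
  where
    /-- triangle inequality for `a + b - c` -/
    abs_add_sub_le_three (a b c : ℝ) : |a + b - c| ≤ |a| + |b| + |c| := by
      calc |a + b - c| ≤ |a + b| + |c| := abs_sub _ _
        _ ≤ |a| + |b| + |c| := by gcongr; exact abs_add_le _ _

/-- **Uniform bound on the Euler mean** `m_s` on `[0, t]` (the integrand is bounded on the slab; `vol 𝕋³ = 1`). -/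
theorem exists_abs_tiltMean_le (hρc : ContinuousOn (Function.uncurry ρ) (Icc 0 t ×ˢ univ))
    (hθc : ContinuousOn (Function.uncurry θ) (Icc 0 t ×ˢ univ))
    (huc : ContinuousOn (Function.uncurry u) (Icc 0 t ×ˢ univ)) (ht : 0 ≤ t) (hθ : ∀ s ∈ Icc 0 t, ∀ x, 0 < θ s x)
    (hΛ : ContinuousOn (fun p : ℝ × T3 => lam0 σ (ρ p.1 p.2) (θ p.1 p.2) (u p.1 p.2)) (Icc 0 t ×ˢ univ)) :
    ∃ M : ℝ, 0 ≤ M ∧ ∀ s ∈ Icc 0 t, |tiltMean σ ρ θ u s| ≤ M := by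
  obtain ⟨R, hR0, hR⟩ := exists_bound_slab (f := fun p : ℝ × T3 => ρ p.1 p.2) hρc
  obtain ⟨A₀, θm, hA₀, hθm, hθmle, hexp⟩ := exists_abs_tiltExponent_le hθc huc ht hθ hΛ
  obtain ⟨U, hU0, hU⟩ := exists_bound_slab (f := fun p : ℝ × T3 => ‖u p.1 p.2‖) (huc.norm)
  -- `|λ₀ + |u|²/(2θ) − 3/2| ≤ A₀ + U²/θm + 3/2` (the tilt exponent at `v = 0` is `λ₀`)
  refine ⟨R * (A₀ + U ^ 2 / θm + 3 / 2), by positivity, fun s hs => ?_⟩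
  have hpt : ∀ x, |ρ s x * (lam0 σ (ρ s x) (θ s x) (u s x) + ‖u s x‖ ^ 2 / (2 * θ s x) - 3 / 2)| ≤
      R * (A₀ + U ^ 2 / θm + 3 / 2) := by
    intro x
    rw [abs_mul]
    refine mul_le_mul (hR s hs x) ?_ (abs_nonneg _) hR0
    have hl : |lam0 σ (ρ s x) (θ s x) (u s x)| ≤ A₀ := by
      have h := hexp s hs x 0
      simp only [tiltExponent, inner_zero_right, zero_div, add_zero, norm_zero, ne_eq, OfNat.ofNat_ne_zero,
        not_false_eq_true, zero_pow, sub_zero] at h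
      exact h
    have hθsx : θm ≤ θ s x := hθmle s hs x
    have hθpos : 0 < θ s x := hθ s hs x
    have hUx : ‖u s x‖ ≤ U := (le_abs_self _).trans (hU s hs x)
    have hq : |‖u s x‖ ^ 2 / (2 * θ s x)| ≤ U ^ 2 / θm := by
      rw [abs_of_nonneg (by positivity), div_le_div_iff₀ (by positivity) hθm]
      have h1 : ‖u s x‖ ^ 2 ≤ U ^ 2 := by gcongr
      nlinarith [sq_nonneg U, hθm.le]
    calc |lam0 σ (ρ s x) (θ s x) (u s x) + ‖u s x‖ ^ 2 / (2 * θ s x) - 3 / 2|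
        ≤ |lam0 σ (ρ s x) (θ s x) (u s x)| + |‖u s x‖ ^ 2 / (2 * θ s x)| + |(3 / 2 : ℝ)| := by
          calc _ ≤ |lam0 σ (ρ s x) (θ s x) (u s x) + ‖u s x‖ ^ 2 / (2 * θ s x)| + |(3 / 2 : ℝ)| := abs_sub _ _
            _ ≤ _ := by gcongr; exact abs_add_le _ _
      _ ≤ A₀ + U ^ 2 / θm + 3 / 2 := by rw [abs_of_pos (by norm_num : (0 : ℝ) < 3 / 2)]; gcongr
  have h := norm_integral_le_of_norm_le_const (μ := (volume : Measure T3))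
    (f := fun x => ρ s x * (lam0 σ (ρ s x) (θ s x) (u s x) + ‖u s x‖ ^ 2 / (2 * θ s x) - 3 / 2))
    (C := R * (A₀ + U ^ 2 / θm + 3 / 2)) (ae_of_all _ fun x => by rw [Real.norm_eq_abs]; exact hpt x)
  rw [Real.norm_eq_abs, probReal_univ, mul_one] at h
  exact h

/-- **Uniform affine energy bound on the linear statistic** (registered sub-goal of this file): on `[0,t]`,
`|ℓ_s(w)| ≤ A₁ + (2/θ_min)·E(w)/(N+1)` with constants uniform in `s`, `N`, `w`. -/
theorem exists_abs_linStat_le : ∀ (σ : ℝ) (ρ θ : ℝ → T3 → ℝ) (u : ℝ → T3 → V3) (t : ℝ), ContinuousOn (Function.uncurry ρ) (Icc 0 t ×ˢ univ) → ContinuousOn (Function.uncurry θ) (Icc 0 t ×ˢ univ) → ContinuousOn (Function.uncurry u) (Icc 0 t ×ˢ univ) → 0 ≤ t → (∀ s ∈ Icc 0 t, ∀ x, 0 < θ s x) → ContinuousOn (fun p : ℝ × T3 => lam0 σ (ρ p.1 p.2) (θ p.1 p.2) (u p.1 p.2)) (Icc 0 t ×ˢ univ) → ∃ A₁ D : ℝ,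 0 ≤ A₁ ∧ 0 < D ∧ ∀ s ∈ Icc 0 t, ∀ (N : ℕ) (w : Fin (N + 1) → T3 × V3), |linStat σ ρ θ u s w| ≤ A₁ + D * (configEnergy w / ((N : ℝ) + 1)) := by
  intro σ ρ θ u t hρc hθc huc ht hθ hΛ
  obtain ⟨A₀, θm, hA₀, hθm, -, hexp⟩ := exists_abs_tiltExponent_le hθc huc ht hθ hΛ
  obtain ⟨M, hM0, hM⟩ := exists_abs_tiltMean_le hρc hθc huc ht hθ hΛ
  refine ⟨A₀ + M, 2 / θm, by positivity, by positivity, fun s hs N w => ?_⟩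
  rw [linStat_eq, tiltPot]
  have hN : (0 : ℝ) < (N : ℝ) + 1 := by positivity
  have hsum : |∑ i, tiltExponent σ ρ θ u s (w i)| ≤ ∑ i, (A₀ + ‖(w i).2‖ ^ 2 / θm) :=
    (Finset.abs_sum_le_sum_abs _ _).trans (Finset.sum_le_sum fun i _ => hexp s hs (w i).1 (w i).2)
  have hE : ∑ i, (A₀ + ‖(w i).2‖ ^ 2 / θm) = ((N : ℝ) + 1) * A₀ + (2 / θm) * configEnergy w := by
    rw [Finset.sum_add_distrib, Finset.sum_const, Finset.card_univ, Fintype.card_fin, nsmul_eq_mul, configEnergy,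
      ← Finset.sum_div]
    push_cast
    field_simp
  calc |((N + 1 : ℕ) : ℝ)⁻¹ * ∑ i, tiltExponent σ ρ θ u s (w i) - tiltMean σ ρ θ u s|
      ≤ |((N + 1 : ℕ) : ℝ)⁻¹ * ∑ i, tiltExponent σ ρ θ u s (w i)| + |tiltMean σ ρ θ u s| := abs_sub _ _
    _ ≤ ((N : ℝ) + 1)⁻¹ * (((N : ℝ) + 1) * A₀ + (2 / θm) * configEnergy w) + M := by
        gcongr
        · rw [abs_mul, Nat.cast_add_one, abs_of_pos (inv_pos.2 hN)]
          exact mul_le_mul_of_nonneg_left (hsum.trans_eq hE) (inv_pos.2 hN).le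
        · exact hM s hs
    _ = A₀ + M + 2 / θm * (configEnergy w / ((N : ℝ) + 1)) := by field_simp; ring

end Summit.AtomisticToContinuum.HydrodynamicLimit.Theorems.FibreDeficitTransfer

end
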